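import Summits.Ventures.LatticeQCDFlow.Exactness.FlowSamplerTauIntFloor
import Summits.Ventures.LatticeQCDFlow.Scaling.FlowAcceptanceCeiling

/-!
HONEST FRAMING: exact (Metropolis-corrected) sampling algorithms for lattice gauge theory; figures
of merit are autocorrelation/cost numbers at stated couplings and volumes; no continuum-physics
claim.

# FlowAutocorrelationFloorAnyGroup — EVERY BOUNDED OBSERVABLE OF AN EXACT FLOW SAMPLER DECORRELATES NO
# FASTER THAN `ρ(n) ≥ (1 − B²·acc/E_π[g²])ⁿ`; FOR THE WILSON MEASURE OF EVERY COMPACT GAUGE GROUP AT EVERY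
# COUPLING `β > 0` AND EVERY MODEL DENSITY `≤ C` OVER THE HAAR PRIOR:
# `ρ(n) ≥ (1 − B²·C·exp(−e^{−βc}⌊L/2⌋^d v_ρ β²/4)/E_β[g²])ⁿ` — AUTOCORRELATIONS STAY EXPONENTIALLY CLOSE TO
# `1` IN THE VOLUME (lean-2 GEN-12, ours)

Venture-side (OURS).  Cell `lqcd-flow` (pub-lqcd), unit `pub-lqcd-lean-2-g12`, 2026-08-23.  GEN-10/11
bounded the ONE-STEP figures of merit of an exact flow sampler (independence Metropolis with the flow's
output law as proposal) for the Wilson measure `μ_β` of every compact gauge group: ESS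
(`TrivializingMaps/FlowESSCeilingAnyGroup`) and stationary acceptance `acc`
(`Scaling/FlowAcceptanceCeiling.wilson_flowAcc_le_allCouplings`: `acc ≤ C·exp(−e^{−βc}⌊L/2⌋^d v_ρ β²/4)` for
a model density `0 ≤ q ≤ C` over `D[U]`), with "autocorrelations" on the NOT CLAIMED list.  This file is
the AUTOCORRELATION law.  It docks row 2's general-space theory of the exact flow sampler's operator
`K = imhOp μ w q` (`Exactness/FlowSamplerPositive`, `FlowSamplerTauIntFloor`: `ρ(1) ≥ r_g` — the
`g²w`-weighted rejection rate — and `ρ(n) ≥ ρ(1)ⁿ` by log-convexity; there for the scalar `φ⁴` rung only)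
to the Wilson target, via one elementary new step: the `g²w`-weighted rejection rate is at least
`1 − B²·(stationary acceptance)/E_π[g²]` for `|g| ≤ B`.

## What is proved

* §1 (general `(X, μ)`, target weight `w > 0`, model density `q > 0`, `∫ q = 1`, `|g| ≤ B` measurable;
  `A = ∫∫ min(w(x)q(y), w(y)q(x)) dμ dμ` the symmetrised acceptance flow, `= Z·acc`):
  `integral_weight_mul_accept_eq` (`∫ w(x)·a(x) dμ = A`, `a(x) = ∫ α(x,y) q(y) dμ` the acceptance
  probability from `x`); `integral_sq_mul_weight_mul_rejection_ge` (`∫ g² w r ≥ ∫ g² w − B²·A`);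
  **`imhOp_autocorr_ge_pow`** — for `∫ g² w > 0` and every `n`:
  `(max 0 (1 − B²·A/∫ g² w))^{n+1} ≤ ρ(n+1) := ∫ g (Kⁿ⁺¹ g) w / ∫ g² w`.
* §2 (the Wilson measure, every compact `G`, `ρ` continuous, every real `β`; model density `q` measurable,
  `0 < q ≤ C`, `∫ q dD[U] = 1`; `w = e^{−βS_W}/∫e^{−βS_W} dD[U]` so that `∫ g² w dD[U] = E_{μ_β}[g²]`):
  **`wilson_flow_autocorr_ge_pow`** — `(max 0 (1 − B²·acc/E_β[g²]))^{n+1} ≤ ρ_g(n+1)` with `acc` the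
  stationary acceptance functional of `Scaling/FlowAcceptanceCeiling`; **`wilson_flow_autocorr_ge_pow_allCouplings`**
  (unitary `ρ`, `d ≥ 2`, `L ≥ 2`, `β ≥ 0`) — `acc` replaced by GEN-11's ceiling:
  `(max 0 (1 − B²·C·exp(−e^{−β·2NK(1+4K)}⌊L/2⌋^d·Var_Haar(Re tr ρ)·β²/4)/E_β[g²]))^{n+1} ≤ ρ_g(n+1)`,
  `K = (d+1)d²`.

Reading (no numerics implied): along the EXACT flow-MCMC chain in equilibrium, the lag-`n` second-moment
autocorrelation `E[g(U_0)g(U_n)]/E[g²]` of every bounded observable (for centred `g = f − ⟨f⟩_β`: the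
autocorrelation function of `f`) is at least `(1 − ε)ⁿ` with `ε = B²·acc/E_β[g²]`; since `acc` is at most
`C` times a quantity exponentially small in the volume at every `β > 0`, an exact flow sampler whose model
density is within a factor `C` of the Haar prior keeps every observable with `E_β[g²] ≫ B²·C·e^{−c(β)·volume}`
correlated for exponentially many steps: its integrated autocorrelation time over any window `W ≤ 1/ε`
is at least of order `W`.  Equivalently: decorrelation in `O(1)` steps REQUIRES `log C ≳ c(β)·volume` — the
model must concentrate exponentially in the volume (the honest capacity reading of GEN-10/11).
NOT CLAIMED: anything about a specific architecture or its training cost; summability / the value of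
`τ_int` (row 2's `imhOp_tauInt_ge` gives `τ_int ≥ (1+ρ(1))/(2(1−ρ(1)))` when the series is summable);
unbounded observables; the continuum.  Literature grade (cell rule): KNOWN MECHANISM (rejection ⇒
positive autocorrelation of the independence sampler: Liu 1996; Mengersen–Tweedie 1996), NEW TYPING
(every compact gauge group, every coupling, every bounded observable, explicit); nothing cited as a fact.
-/

noncomputable section

open MeasureTheory ProbabilityTheory Real Set Filter
open Literature.MathematicalPhysics.QuantumFieldTheory
open Literature.MathematicalPhysics.QuantumFieldTheory.Luscher2010
open Summit.Ventures.LatticeQCDFlow.Exactness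
open Summit.Ventures.LatticeQCDFlow.Scaling

namespace Summit.Ventures.LatticeQCDFlow.TrivializingMaps

/-! ## §1 General state space: the rejection rate is at least `1 − B²·acc/E[g²]` -/

section General

variable {X : Type*} [MeasurableSpace X] {μ : Measure X} [SFinite μ] {w q : X → ℝ}

omit [MeasurableSpace X] [SFinite μ] in
/-- `w(x)·α(x,y)·q(y) = min(w(x)q(y), w(y)q(x))`: the accepted flow from `x` to `y` is the symmetrised
flow. [folklore] -/
theorem weight_mul_imhAcceptQ_mul (hw0 : ∀ t, 0 < w t) (hq0 : ∀ t, 0 < q t) (x y : X) :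
    w x * (imhAcceptQ w q x y * q y) = min (w x * q y) (w y * q x) := by
  unfold imhAcceptQ
  have hwx := (hw0 x).ne'
  have hqy := (hq0 y).ne'
  rw [show w x * (min 1 (w y * q x / (w x * q y)) * q y) = (w x * q y) * min 1 (w y * q x / (w x * q y))
    by ring, mul_min_of_nonneg _ _ (mul_pos (hw0 x) (hq0 y)).le, mul_one]
  congr 1
  field_simp

/-- **The stationary accepted mass is the symmetrised flow**: `∫ w(x)·a(x) dμ = ∫∫ min(w(x)q(y), w(y)q(x))`,
`a(x) = ∫ α(x,y) q(y) dμ(y)` the acceptance probability from `x`. [folklore] -/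
theorem integral_weight_mul_accept_eq (hw0 : ∀ t, 0 < w t) (hwm : Measurable w) (hwi : Integrable w μ)
    (hq0 : ∀ t, 0 < q t) (hqm : Measurable q) (hqi : Integrable q μ) :
    ∫ x, w x * (∫ y, imhAcceptQ w q x y * q y ∂μ) ∂μ =
      ∫ z, min (w z.1 * q z.2) (w z.2 * q z.1) ∂(μ.prod μ) := by
  have hF : Integrable (fun z : X × X => min (w z.1 * q z.2) (w z.2 * q z.1)) (μ.prod μ) := by
    refine Integrable.mono' (hwi.mul_prod hqi)
      (((hwm.comp measurable_fst).mul (hqm.comp measurable_snd)).min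
        ((hwm.comp measurable_snd).mul (hqm.comp measurable_fst))).aestronglyMeasurable
      (Eventually.of_forall fun z => ?_)
    rw [Real.norm_eq_abs, abs_of_nonneg (le_min (mul_nonneg (hw0 _).le (hq0 _).le)
      (mul_nonneg (hw0 _).le (hq0 _).le))]
    exact min_le_left _ _
  rw [integral_prod _ hF]
  refine integral_congr_ae (Eventually.of_forall fun x => ?_)
  simp only
  rw [← integral_const_mul]
  exact integral_congr_ae (Eventually.of_forall fun y => weight_mul_imhAcceptQ_mul hw0 hq0 x y)

/-- **THE WEIGHTED REJECTION RATE IS AT LEAST `1 − B²·acc/E[g²]`** (un-normalised form): for `|g| ≤ B`,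
`∫ g² w r dμ ≥ ∫ g² w dμ − B²·∫∫ min(w(x)q(y), w(y)q(x))`, `r(x) = ∫ (1 − α(x,y)) q(y) dμ(y)`. [ours] -/
theorem integral_sq_mul_weight_mul_rejection_ge (hw0 : ∀ t, 0 < w t) (hwm : Measurable w)
    (hwi : Integrable w μ) (hq0 : ∀ t, 0 < q t) (hqm : Measurable q) (hqi : Integrable q μ)
    (hq1 : ∫ t, q t ∂μ = 1) {g : X → ℝ} (hgm : Measurable g) {B : ℝ} (hgb : ∀ t, |g t| ≤ B) :
    (∫ t, g t ^ 2 * w t ∂μ) - B ^ 2 * ∫ z, min (w z.1 * q z.2) (w z.2 * q z.1) ∂(μ.prod μ) ≤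
      ∫ t, g t ^ 2 * w t * (∫ t', (1 - imhAcceptQ w q t t') * q t' ∂μ) ∂μ := by
  -- the acceptance probability from `t`
  have hαi : ∀ t, Integrable (fun t' => imhAcceptQ w q t t' * q t') μ := fun t =>
    Integrable.mono' hqi (((measurable_imhAcceptQ hwm hqm).comp (measurable_prodMk_left)).mul hqm
      |>.aestronglyMeasurable) (Eventually.of_forall fun t' => by
        rw [Real.norm_eq_abs, abs_of_nonneg (mul_nonneg (imhAcceptQ_nonneg hw0 hq0 t t') (hq0 t').le)]
        exact mul_le_of_le_one_left (hq0 t').le (imhAcceptQ_le_one w q t t'))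
  have hr : ∀ t, ∫ t', (1 - imhAcceptQ w q t t') * q t' ∂μ = 1 - ∫ t', imhAcceptQ w q t t' * q t' ∂μ := by
    intro t
    have : (fun t' => (1 - imhAcceptQ w q t t') * q t') = fun t' => q t' - imhAcceptQ w q t t' * q t' := by
      funext t'; ring
    rw [this, integral_sub hqi (hαi t), hq1]
  have ha0 : ∀ t, 0 ≤ ∫ t', imhAcceptQ w q t t' * q t' ∂μ := fun t =>
    integral_nonneg fun t' => mul_nonneg (imhAcceptQ_nonneg hw0 hq0 t t') (hq0 t').le
  -- measurability of `a`
  have ham : Measurable fun t => ∫ t', imhAcceptQ w q t t' * q t' ∂μ := by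
    have hF : Measurable fun p : X × X => imhAcceptQ w q p.1 p.2 * q p.2 :=
      (measurable_imhAcceptQ hwm hqm).mul (hqm.comp measurable_snd)
    exact (hF.stronglyMeasurable.integral_prod_right' (ν := μ)).measurable
  -- integrability of `g² w` and `g² w a`
  have hg2 : ∀ t, g t ^ 2 ≤ B ^ 2 := fun t => by
    rw [← sq_abs]; exact pow_le_pow_left₀ (abs_nonneg _) (hgb t) 2
  have hI1 : Integrable (fun t => g t ^ 2 * w t) μ :=
    Integrable.mono' (hwi.const_mul (B ^ 2)) ((hgm.pow_const 2).mul hwm).aestronglyMeasurable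
      (Eventually.of_forall fun t => by
        rw [Real.norm_eq_abs, abs_of_nonneg (mul_nonneg (sq_nonneg _) (hw0 t).le)]
        exact mul_le_mul_of_nonneg_right (hg2 t) (hw0 t).le)
  have hI2 : Integrable (fun t => g t ^ 2 * w t * ∫ t', imhAcceptQ w q t t' * q t' ∂μ) μ := by
    refine Integrable.mono' (hwi.const_mul (B ^ 2)) (((hgm.pow_const 2).mul hwm).mul ham).aestronglyMeasurable
      (Eventually.of_forall fun t => ?_)
    have ha1 : ∫ t', imhAcceptQ w q t t' * q t' ∂μ ≤ 1 := by
      calc ∫ t', imhAcceptQ w q t t' * q t' ∂μ ≤ ∫ t', q t' ∂μ :=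
            integral_mono (hαi t) hqi fun t' => mul_le_of_le_one_left (hq0 t').le (imhAcceptQ_le_one w q t t')
        _ = 1 := hq1
    rw [Real.norm_eq_abs, abs_of_nonneg (mul_nonneg (mul_nonneg (sq_nonneg _) (hw0 t).le) (ha0 t))]
    calc g t ^ 2 * w t * ∫ t', imhAcceptQ w q t t' * q t' ∂μ ≤ g t ^ 2 * w t * 1 :=
          mul_le_mul_of_nonneg_left ha1 (mul_nonneg (sq_nonneg _) (hw0 t).le)
      _ ≤ B ^ 2 * w t := by rw [mul_one]; exact mul_le_mul_of_nonneg_right (hg2 t) (hw0 t).le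
  have hIwa : Integrable (fun t => w t * ∫ t', imhAcceptQ w q t t' * q t' ∂μ) μ := by
    refine Integrable.mono' hwi (hwm.mul ham).aestronglyMeasurable (Eventually.of_forall fun t => ?_)
    have ha1 : ∫ t', imhAcceptQ w q t t' * q t' ∂μ ≤ 1 := by
      calc ∫ t', imhAcceptQ w q t t' * q t' ∂μ ≤ ∫ t', q t' ∂μ :=
            integral_mono (hαi t) hqi fun t' => mul_le_of_le_one_left (hq0 t').le (imhAcceptQ_le_one w q t t')
        _ = 1 := hq1
    rw [Real.norm_eq_abs, abs_of_nonneg (mul_nonneg (hw0 t).le (ha0 t))]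
    exact mul_le_of_le_one_right (hw0 t).le ha1
  -- `∫ g² w r = ∫ g² w − ∫ g² w a` and `∫ g² w a ≤ B² ∫ w a = B² A`
  have hsplit : ∫ t, g t ^ 2 * w t * (∫ t', (1 - imhAcceptQ w q t t') * q t' ∂μ) ∂μ =
      (∫ t, g t ^ 2 * w t ∂μ) - ∫ t, g t ^ 2 * w t * ∫ t', imhAcceptQ w q t t' * q t' ∂μ ∂μ := by
    rw [← integral_sub hI1 hI2]
    refine integral_congr_ae (Eventually.of_forall fun t => ?_)
    simp only [hr t]
    ring
  have hbound : ∫ t, g t ^ 2 * w t * ∫ t', imhAcceptQ w q t t' * q t' ∂μ ∂μ ≤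
      B ^ 2 * ∫ z, min (w z.1 * q z.2) (w z.2 * q z.1) ∂(μ.prod μ) := by
    rw [← integral_weight_mul_accept_eq hw0 hwm hwi hq0 hqm hqi, ← integral_const_mul]
    refine integral_mono hI2 (hIwa.const_mul _) fun t => ?_
    simp only
    rw [← mul_assoc]
    exact mul_le_mul_of_nonneg_right (mul_le_mul_of_nonneg_right (hg2 t) (hw0 t).le) (ha0 t)
  rw [hsplit]
  linarith

/-- **ALL-LAG AUTOCORRELATION FLOOR FROM THE STATIONARY ACCEPTANCE**: for a bounded measurable `g`
(`|g| ≤ B`) with `∫ g² w > 0` and every `n`,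
`(max 0 (1 − B²·A/∫ g² w))^{n+1} ≤ ρ(n+1) := ∫ g (Kⁿ⁺¹ g) w / ∫ g² w`, `A = ∫∫ min(w(x)q(y), w(y)q(x))`
(so `A/∫w` is the stationary acceptance rate).  Row 2's `ρ(1) ≥ r_g` and `ρ(n+1) ≥ ρ(1)^{n+1}` with §1's
rejection floor. [ours] -/
theorem imhOp_autocorr_ge_pow (hw0 : ∀ t, 0 < w t) (hwm : Measurable w) (hwi : Integrable w μ)
    (hq0 : ∀ t, 0 < q t) (hqm : Measurable q) (hqi : Integrable q μ) (hq1 : ∫ t, q t ∂μ = 1)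
    {g : X → ℝ} (hgm : Measurable g) {B : ℝ} (hgb : ∀ t, |g t| ≤ B)
    (hpos : 0 < ∫ t, g t ^ 2 * w t ∂μ) (n : ℕ) :
    (max 0 (1 - B ^ 2 * (∫ z, min (w z.1 * q z.2) (w z.2 * q z.1) ∂(μ.prod μ)) / ∫ t, g t ^ 2 * w t ∂μ))
        ^ (n + 1) ≤
      (∫ t, g t * ((imhOp μ w q)^[n + 1] g) t * w t ∂μ) / ∫ t, g t ^ 2 * w t ∂μ := by
  have hrej := rejection_le_autocorr_one hw0 hwm hwi hq0 hqm hqi hq1 hgm hgb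
  have hfloor := integral_sq_mul_weight_mul_rejection_ge hw0 hwm hwi hq0 hqm hqi hq1 hgm hgb
  have hpow := autocorr_pow_le hw0 hwm hwi hq0 hqm hqi hq1 hgm hgb n
  -- `max 0 (1 − B²A/E) ≤ r_g ≤ ρ(1)`
  have hr0 : 0 ≤ (∫ t, g t ^ 2 * w t * (∫ t', (1 - imhAcceptQ w q t t') * q t' ∂μ) ∂μ) /
      ∫ t, g t ^ 2 * w t ∂μ := by
    refine div_nonneg (integral_nonneg fun t => mul_nonneg (mul_nonneg (sq_nonneg _) (hw0 t).le) ?_)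
      hpos.le
    exact (rejection_bounds hw0 hwm hq0 hqm hqi hq1).1 t
  have h1 : max 0 (1 - B ^ 2 * (∫ z, min (w z.1 * q z.2) (w z.2 * q z.1) ∂(μ.prod μ)) /
      ∫ t, g t ^ 2 * w t ∂μ) ≤ (∫ t, g t * imhOp μ w q g t * w t ∂μ) / ∫ t, g t ^ 2 * w t ∂μ := by
    refine max_le (hr0.trans hrej) (le_trans ?_ hrej)
    rw [le_div_iff₀ hpos, sub_mul, one_mul, div_mul_cancel₀ _ hpos.ne']
    exact hfloor
  exact (pow_le_pow_left₀ (le_max_left _ _) h1 (n + 1)).trans hpow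

end General

/-! ## §2 The Wilson measure, every compact gauge group -/

section Wilson

variable {d L N : ℕ} [NeZero L] {G : Type*} [Group G] [TopologicalSpace G] [IsTopologicalGroup G]
  [CompactSpace G] [MeasurableSpace G] [BorelSpace G] [SecondCountableTopology G]
  (ρ : G →* Matrix (Fin N) (Fin N) ℂ)

/-- The normalised Wilson density `p = e^{β(−S_W)}/mgf(β)` over `D[U]` integrates an observable to its
Wilson expectation: `∫ h·p dD[U] = ∫ h dμ_β`. [folklore] -/
theorem integral_mul_wilsonDensity_eq (hρ : Continuous ρ) (β : ℝ) (h : GaugeConfig d L G → ℝ) :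
    ∫ U, h U * (exp (β * (-wilsonAction ρ U)) / mgf (fun U => -wilsonAction ρ U) (trivialMeasure G d L) β)
        ∂(trivialMeasure G d L) =
      ∫ U, h U ∂(wilsonMeasure (d := d) (L := L) ρ β) := by
  rw [wilsonMeasure_eq_tilted_neg ρ hρ β, integral_tilted]
  refine integral_congr_ae (ae_of_all _ fun U => ?_)
  simp only [smul_eq_mul, mgf]
  ring

/-- **AUTOCORRELATION FLOOR FOR THE EXACT FLOW SAMPLER OF THE WILSON MEASURE, EVERY COMPACT GAUGE GROUP,
EVERY COUPLING**: for a measurable model density `q > 0` over `D[U]` with `∫ q dD[U] = 1`, a bounded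
measurable observable `g` (`|g| ≤ B`) with `E_{μ_β}[g²] > 0`, and every `n`:
`(max 0 (1 − B²·acc/E_{μ_β}[g²]))^{n+1} ≤ ρ_g(n+1)`, where `acc = ∫∫ min(p(U)q(V), p(V)q(U)) dD dD` is the
stationary acceptance (`Scaling/FlowAcceptanceCeiling.wilson_flowAcc_reading`) and
`ρ_g(n) = E_{μ_β}[g·(Kⁿg)]/E_{μ_β}[g²]` the stationary second-moment autocorrelation along the exact
chain (`K = imhOp D[U] p q`). [ours] -/
theorem wilson_flow_autocorr_ge_pow (hρ : Continuous ρ) (β : ℝ) {q : GaugeConfig d L G → ℝ}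
    (hqm : Measurable q) (hq0 : ∀ U, 0 < q U) (hq1 : ∫ U, q U ∂(trivialMeasure G d L) = 1)
    {g : GaugeConfig d L G → ℝ} (hgm : Measurable g) {B : ℝ} (hgb : ∀ U, |g U| ≤ B)
    (hpos : 0 < ∫ U, g U ^ 2 ∂(wilsonMeasure (d := d) (L := L) ρ β)) (n : ℕ) :
    (max 0 (1 - B ^ 2 *
        (∫ z, min (exp (β * (-wilsonAction ρ z.1)) /
              mgf (fun U => -wilsonAction ρ U) (trivialMeasure G d L) β * q z.2)
            (exp (β * (-wilsonAction ρ z.2)) /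
              mgf (fun U => -wilsonAction ρ U) (trivialMeasure G d L) β * q z.1)
            ∂((trivialMeasure G d L).prod (trivialMeasure G d L))) /
        ∫ U, g U ^ 2 ∂(wilsonMeasure (d := d) (L := L) ρ β))) ^ (n + 1) ≤
      (∫ U, g U * ((imhOp (trivialMeasure G d L)
          (fun U => exp (β * (-wilsonAction ρ U)) / mgf (fun U => -wilsonAction ρ U) (trivialMeasure G d L) β)
          q)^[n + 1] g) U ∂(wilsonMeasure (d := d) (L := L) ρ β)) /
        ∫ U, g U ^ 2 ∂(wilsonMeasure (d := d) (L := L) ρ β) := by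
  haveI : IsProbabilityMeasure (trivialMeasure G d L) := trivialMeasure_isProbabilityMeasure
  set w : GaugeConfig d L G → ℝ := fun U => exp (β * (-wilsonAction ρ U)) /
    mgf (fun U => -wilsonAction ρ U) (trivialMeasure G d L) β with hw
  have hmgf : 0 < mgf (fun U => -wilsonAction ρ U) (trivialMeasure G d L) β :=
    mgf_pos (integrable_trivialMeasure_of_continuous_group
      (continuous_exp.comp (continuous_const.mul (continuous_wilsonAction_of_continuous ρ hρ).neg)))
  have hw0 : ∀ U, 0 < w U := fun U => div_pos (exp_pos _) hmgf
  have hwc : Continuous w :=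
    (continuous_exp.comp (continuous_const.mul (continuous_wilsonAction_of_continuous ρ hρ).neg)).div_const _
  have hwm : Measurable w := hwc.measurable
  have hwi : Integrable w (trivialMeasure G d L) := integrable_trivialMeasure_of_continuous_group hwc
  have hqi : Integrable q (trivialMeasure G d L) := by
    by_contra h
    rw [integral_undef h] at hq1
    exact zero_ne_one hq1
  have e2 : ∫ U, g U ^ 2 * w U ∂(trivialMeasure G d L) = ∫ U, g U ^ 2 ∂(wilsonMeasure (d := d) (L := L) ρ β) :=
    integral_mul_wilsonDensity_eq ρ hρ β _
  have en : ∫ U, g U * ((imhOp (trivialMeasure G d L) w q)^[n + 1] g) U * w U ∂(trivialMeasure G d L) =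
      ∫ U, g U * ((imhOp (trivialMeasure G d L) w q)^[n + 1] g) U ∂(wilsonMeasure (d := d) (L := L) ρ β) :=
    integral_mul_wilsonDensity_eq ρ hρ β _
  have hpos' : 0 < ∫ U, g U ^ 2 * w U ∂(trivialMeasure G d L) := by rwa [e2]
  have h := imhOp_autocorr_ge_pow hw0 hwm hwi hq0 hqm hqi hq1 hgm hgb hpos' n
  rw [e2, en] at h
  exact h

/-- **AT EVERY COUPLING, EVERY COMPACT GAUGE GROUP, EXPLICITLY** (unitary `ρ`, `d ≥ 2`, `L ≥ 2`, `β ≥ 0`,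
model density `0 < q ≤ C`): for every bounded measurable `g` with `E_{μ_β}[g²] > 0` and every `n`,
`(max 0 (1 − B²·C·exp(−e^{−β·2NK(1+4K)}·⌊L/2⌋^d·Var_Haar(Re tr ρ)·β²/4)/E_{μ_β}[g²]))^{n+1} ≤ ρ_g(n+1)`,
`K = (d+1)d²` — the autocorrelations of the exact flow sampler stay exponentially close to `1` in the
volume unless the model density bound `C` is itself exponentially large in the volume. [ours] -/
theorem wilson_flow_autocorr_ge_pow_allCouplings (hd : 2 ≤ d) (hL : 2 ≤ L) (hρ : Continuous ρ)
    (hρu : ∀ g, ρ g ∈ Matrix.unitaryGroup (Fin N) ℂ) {β : ℝ} (hβ : 0 ≤ β)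
    {q : GaugeConfig d L G → ℝ} (hqm : Measurable q) (hq0 : ∀ U, 0 < q U) {C : ℝ} (hqC : ∀ U, q U ≤ C)
    (hq1 : ∫ U, q U ∂(trivialMeasure G d L) = 1)
    {g : GaugeConfig d L G → ℝ} (hgm : Measurable g) {B : ℝ} (hgb : ∀ U, |g U| ≤ B)
    (hpos : 0 < ∫ U, g U ^ 2 ∂(wilsonMeasure (d := d) (L := L) ρ β)) (n : ℕ) :
    (max 0 (1 - B ^ 2 * (C * exp (-(Real.exp (-(β * (2 * N * ((d + 1) * d ^ 2 : ℕ) *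
        (1 + 4 * ((d + 1) * d ^ 2 : ℕ))))) * ((L / 2) ^ d : ℕ) *
        variance (fun g => (ρ g).trace.re) (haarProbability G) * β ^ 2 / 4))) /
        ∫ U, g U ^ 2 ∂(wilsonMeasure (d := d) (L := L) ρ β))) ^ (n + 1) ≤
      (∫ U, g U * ((imhOp (trivialMeasure G d L)
          (fun U => exp (β * (-wilsonAction ρ U)) / mgf (fun U => -wilsonAction ρ U) (trivialMeasure G d L) β)
          q)^[n + 1] g) U ∂(wilsonMeasure (d := d) (L := L) ρ β)) /
        ∫ U, g U ^ 2 ∂(wilsonMeasure (d := d) (L := L) ρ β) := by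
  have hacc := wilson_flowAcc_le_allCouplings (d := d) (L := L) ρ hd hL hρ hρu hβ hqm
    (fun U => (hq0 U).le) hqC
  refine le_trans ?_ (wilson_flow_autocorr_ge_pow ρ hρ β hqm hq0 hq1 hgm hgb hpos n)
  have hB2 : 0 ≤ B ^ 2 := sq_nonneg B
  refine pow_le_pow_left₀ (le_max_left _ _) (max_le_max le_rfl ?_) (n + 1)
  refine sub_le_sub_left (div_le_div_of_nonneg_right (mul_le_mul_of_nonneg_left hacc hB2) hpos.le) 1

end Wilson

end Summit.Ventures.LatticeQCDFlow.TrivializingMaps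

end
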